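import Literature.RepresentationTheory.HeisenbergGroup.QuasiInvariantFunctionalSiegelTransport
import Literature.RepresentationTheory.HeisenbergGroup.SchrodingerPartialFourierWeyl
import Literature.RepresentationTheory.HeisenbergGroup.SchwartzBruhatQuadricUncertainty
import Literature.NumberTheory.GelbartRogawski1991.LocalLeraySection
import Literature.NumberTheory.Automorphic.AddCharConductorExponent
import HarnessLib

/-!
# The analytic engine of the rank-one theta dichotomy: no non-zero functional is quasi-invariant under two
# root families in opposite Siegel positions with anisotropic second-degree characters

Topic `RepresentationTheory/HeisenbergGroup`; namespace `Literature.RepresentationTheory.HeisenbergGroup`.  ONE THEOREM (no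
definition, no named fact, no `sorry`); nothing about unitary groups or theta lifts.

Setting: a finite place `v` of a number field `F`, the local Schrödinger model `ρ = localSchrodinger F N T₂ v` of
`S̃p_ψ(𝕎_v)` on `𝒮(F_v^N)` for a Gram matrix `T₂` with unit determinant (`β = localPairing F N T₂ v`,
`Sp = LocalSp F N T₂ v`, `S̃p_ψ = LocalMp F N T₂ v`, [GelbartRogawski1991/LocalUnitarySplittingDatum]), a coordinate splitting
`e' : ι₁ ⊕ ι₂ ≃ Fin N` (`ι₁ ≠ ∅`), and:

* a linear functional `Λ ≠ 0` on `𝒮(F_v^N)`;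
* two ONE-PARAMETER FAMILIES `t ↦ p t`, `t ↦ p' t` in `S̃p_ψ` (root subgroups) under each member of which `Λ` is an
  eigenvector (`Λ ∘ op(p t) = κ_t Λ`);
* a symplectic `g₀` (the polarisation mover) and two `β`-symmetric maps `c₀, c₀'` SUPPORTED ON THE `ι₁`-BLOCK
  (`β(x, c₀ x) = β(x̃, c₀ x̃)`, `x̃ = x|ι₁ ⊔ 0`) whose second-degree characters are ANISOTROPIC in the `ι₁`-variables
  (`β(ξ ⊔ 0, c₀(ξ ⊔ 0)) = 0 ⇒ ξ = 0`), such that `g₀` conjugates `π(p t)` to the Siegel unipotent `n(t • c₀)` and `π(p' t)`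
  to `w n(t • c₀') w⁻¹`, `w = partialWeyl` the Weyl element of the `ι₁`-block (implemented by the partial Fourier transform
  `𝓕_{x'} ⊠ 1`, `implements_partialWeyl_boxFourier`).

CONCLUSION `false_of_quasiInvariant_rootFamilies`: contradiction.  Proof = the chain of the cell's pieces P5–P6: with
`q = (g₀, M₀)` (`existsImplementer_localSchrodinger`) and `D := Λ ∘ M₀⁻¹`, `QuasiInvariantFunctionalSiegelTransport` turns the
two conjugation identities into the eigen-hypotheses `hD` / `hDF` of
`SchwartzBruhatQuadricUncertainty.eq_zero_of_quadric_eigen_of_partialFourier_quadric_eigen` for the quaternary-type forms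
`Q ξ = −½β(ξ ⊔ 0, c₀(ξ ⊔ 0))`, `Q₂` likewise for `c₀'` (anisotropic quadratic forms: bounded level sets / empty interior,
`QuadraticMap.levelSet_subset_piPrimePowBall_of_anisotropic`, `…interior_levelSet_eq_empty_of_anisotropic`); hence `D = 0`,
hence `Λ = D ∘ M₀ = 0`.  [MoeglinVignerasWaldspurger1987, Chap. 2 II.6–II.7] — the support argument behind the dichotomy
[HarrisKudlaSweet1996, Cor. 4.4].

Use (cell hodgecm-mathlib, row IV-4(c1) `rankOne_theta_lines_disjoint`, KEY `b4-rank-one-theta-lines-disjoint`, P7): `N = 3+3`,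
`T₂ = gramD F 3 T`, `Λ` the doubled functional of P1 (`exists_doubledFunctional_of_areIsomorphicRep`), `p t = 𝔻(n_t(r))`,
`p' t = 𝔻(n_t(r'))` the diagonally doubled root subgroups of an isotropic vector and its hyperbolic partner (P2/P3),
`(g₀, c₀, c₀')` from the polarisation mover (P4), anisotropy from `¬ SameClass(ε₁, ε₂)` (P3).

## References
* [MoeglinVignerasWaldspurger1987] C. Mœglin, M.-F. Vignéras, J.-L. Waldspurger, LNM 1291 (1987), Chap. 2 II.1 (A), II.6–II.7.
* [HarrisKudlaSweet1996] M. Harris, S. Kudla, W. Sweet, J. AMS 9 (1996), §4 Cor. 4.4, §6.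
* [WeilBNT1967] A. Weil, *Basic Number Theory* (1967), Chap. VII §2.
-/

set_option autoImplicit false

noncomputable section

open NumberField IsDedekindDomain MeasureTheory Matrix
open Literature.NumberTheory.Automorphic
open Literature.NumberTheory.GelbartRogawski1991.UnitaryDualPair.LocalSplitting

namespace Literature.RepresentationTheory.HeisenbergGroup

variable (F : Type) [Field F] [NumberField F] (v : HeightOneSpectrum (𝓞 F)) (N : ℕ) (T₂ : Matrix (Fin N) (Fin N) F)

/-! `⅟2` in `F_v` is the tree's instance `instInvertibleTwoAdicCompletion` (`RankOneFiniteAdeleWeil`); no local instance is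
introduced here (two `Invertible (2 : F_v)` instances would not be definitionally equal cheaply). -/

/-- the second-degree datum `x ↦ ½ β(x, (t • c) x)` of a Siegel unipotent is continuous on `F_v^N`. [cite: WeilBNT1967, Chap. II §1] -/
theorem continuous_half_localPairing_smul_apply (c : (Fin N → v.adicCompletion F) →ₗ[v.adicCompletion F]
    (Fin N → v.adicCompletion F)) (t : v.adicCompletion F) :
    Continuous fun x : Fin N → v.adicCompletion F => ⅟(2 : v.adicCompletion F) * localPairing F N T₂ v x ((t • c) x) := by
  have hc : Continuous (c : (Fin N → v.adicCompletion F) → (Fin N → v.adicCompletion F)) := c.continuous_on_pi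
  simp only [Matrix.toLinearMap₂'_apply', LinearMap.smul_apply]
  exact continuous_const.mul (continuous_id.dotProduct (continuous_const.matrix_mulVec ((hc.const_smul t))))

/-- the `ι₁`-block second-degree function `ξ ↦ −½ β(ξ ⊔ 0, c (ξ ⊔ 0))` is continuous on `F_v^{ι₁}`. [cite: WeilBNT1967, Chap. II §1] -/
theorem continuous_neg_half_localPairing_glue {ι₁ ι₂ : Type} (e' : ι₁ ⊕ ι₂ ≃ Fin N)
    (c : (Fin N → v.adicCompletion F) →ₗ[v.adicCompletion F] (Fin N → v.adicCompletion F)) :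
    Continuous fun ξ : ι₁ → v.adicCompletion F =>
      -(⅟(2 : v.adicCompletion F) * localPairing F N T₂ v (glue e' ξ 0) (c (glue e' ξ 0))) := by
  have hc : Continuous (c : (Fin N → v.adicCompletion F) → (Fin N → v.adicCompletion F)) := c.continuous_on_pi
  have hg : Continuous fun ξ : ι₁ → v.adicCompletion F => glue e' ξ (0 : ι₂ → v.adicCompletion F) :=
    (continuous_glue e').comp (continuous_id.prodMk continuous_const)
  simp only [Matrix.toLinearMap₂'_apply']
  exact (continuous_const.mul (hg.dotProduct (continuous_const.matrix_mulVec (hc.comp hg)))).neg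

set_option maxHeartbeats 1000000 in -- the two eigen-hypotheses are large dependent statements; elaboration ≈ 20 s
/-- **THE ENGINE.**  No non-zero linear functional on `𝒮(F_v^N)` is an eigenvector of two one-parameter families of
`S̃p_ψ(𝕎_v)` which a common symplectic `g₀` conjugates onto a Siegel-LOWER family `n(t • c₀)` and onto the
`partialWeyl`-conjugate of a Siegel-lower family `n(t • c₀')`, both with `ι₁`-supported ANISOTROPIC second-degree
characters.  (Transport `D = Λ ∘ M₀⁻¹`; `D` is an eigendistribution of the characters `ψ(t Q(x'))` and `D ∘ (𝓕_{x'} ⊠ 1)` of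
the characters `ψ(t Q₂(x'))`; a distribution carried by a compact quadric shell whose partial Fourier transform is carried by
a thin shell vanishes.) [cite: MoeglinVignerasWaldspurger1987, Chap. 2 II.6–II.7] [cite: HarrisKudlaSweet1996, §4 Cor. 4.4] -/
theorem false_of_quasiInvariant_rootFamilies (hT₂d : IsUnit T₂.det) {ι₁ ι₂ : Type} [Fintype ι₁] [Fintype ι₂]
    [DecidableEq ι₁] [DecidableEq ι₂] [Nonempty ι₁] (e' : ι₁ ⊕ ι₂ ≃ Fin N)
    (Λ : SchwartzBruhat (Fin N → v.adicCompletion F) →ₗ[ℂ] ℂ) (hΛ0 : Λ ≠ 0)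
    (g₀ : LocalSp F N T₂ v) (p p' : v.adicCompletion F → LocalMp F N T₂ v)
    (hΛp : ∀ t, ∃ κ : ℂ, ∀ f, Λ (MpPsi.toOp _ (p t) f) = κ • Λ f)
    (hΛp' : ∀ t, ∃ κ : ℂ, ∀ f, Λ (MpPsi.toOp _ (p' t) f) = κ • Λ f)
    (c₀ c₀' : (Fin N → v.adicCompletion F) →ₗ[v.adicCompletion F] (Fin N → v.adicCompletion F))
    (hc₀ : ∀ x x', localPairing F N T₂ v x (c₀ x') = localPairing F N T₂ v x' (c₀ x))
    (hc₀' : ∀ x x', localPairing F N T₂ v x (c₀' x') = localPairing F N T₂ v x' (c₀' x))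
    (hsupp : ∀ x, localPairing F N T₂ v x (c₀ x) =
      localPairing F N T₂ v (glue e' (resL e' x) 0) (c₀ (glue e' (resL e' x) 0)))
    (hsupp' : ∀ x, localPairing F N T₂ v x (c₀' x) =
      localPairing F N T₂ v (glue e' (resL e' x) 0) (c₀' (glue e' (resL e' x) 0)))
    (hanis : ∀ ξ : ι₁ → v.adicCompletion F, localPairing F N T₂ v (glue e' ξ 0) (c₀ (glue e' ξ 0)) = 0 → ξ = 0)
    (hanis' : ∀ ξ : ι₁ → v.adicCompletion F, localPairing F N T₂ v (glue e' ξ 0) (c₀' (glue e' ξ 0)) = 0 → ξ = 0)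
    (hconj : ∀ t, g₀ * MpPsi.proj _ (p t) * g₀⁻¹ =
      unipotentSp (localPairing F N T₂ v) (t • c₀) (symm_smul_of_symm (localPairing F N T₂ v) c₀ hc₀ t))
    (hconj' : ∀ t, g₀ * MpPsi.proj _ (p' t) * g₀⁻¹ =
      partialWeyl (localGram F N T₂ v) (UnitaryGroup.isUnit_det_map (algebraMap F (v.adicCompletion F)) hT₂d) e' *
        unipotentSp (localPairing F N T₂ v) (t • c₀') (symm_smul_of_symm (localPairing F N T₂ v) c₀' hc₀' t) *
        (partialWeyl (localGram F N T₂ v) (UnitaryGroup.isUnit_det_map (algebraMap F (v.adicCompletion F)) hT₂d) e')⁻¹) :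
    False := by
  classical
  -- local data: the character `ψ_v`, its conductor, `½`, the Haar measure on `F_v^{ι₁}`
  have hψ := isContinuousNontrivial_adeleAddCharAt F v
  obtain ⟨m, hm⟩ := hψ.exists_hasConductorExp
  letI : MeasurableSpace (ι₁ → v.adicCompletion F) := borel _
  haveI : BorelSpace (ι₁ → v.adicCompletion F) := ⟨rfl⟩
  obtain ⟨μ₁, hμ₁⟩ : ∃ μ₁ : Measure (ι₁ → v.adicCompletion F), μ₁.IsAddHaarMeasure := ⟨Measure.addHaar, inferInstance⟩
  have hA : IsUnit (localGram F N T₂ v).det := UnitaryGroup.isUnit_det_map (algebraMap F (v.adicCompletion F)) hT₂d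
  have hl : IsLocallyConstant (⇑(adeleAddCharAt F v) : v.adicCompletion F → Circle) :=
    isLocallyConstant_of_isContinuousNontrivial hψ
  have hb : ∀ y : Fin N → v.adicCompletion F, Continuous fun u : Fin N → v.adicCompletion F => localPairing F N T₂ v u y :=
    continuous_toLinearMap₂'_left' (K := v.adicCompletion F) (localGram F N T₂ v)
  have hU : ImplementerUniqueUpToScalar
      (schrodingerSB (localPairing F N T₂ v) (adeleAddCharAt F v) hl hb) :=
    implementerUniqueUpToScalar_localSchrodinger F N T₂ hT₂d v
  -- the mover pair `q = (g₀, M₀)`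
  obtain ⟨M₀, hM₀⟩ := existsImplementer_localSchrodinger F N T₂ hT₂d v g₀
  let q : MpPsi (schrodingerSB (localPairing F N T₂ v) (adeleAddCharAt F v) hl hb) := ⟨(g₀, M₀), hM₀⟩
  have hq : MpPsi.proj _ q = g₀ := rfl
  -- continuity of the second-degree data
  have hqc : ∀ t : v.adicCompletion F, Continuous fun x : Fin N → v.adicCompletion F =>
      ⅟(2 : v.adicCompletion F) * localPairing F N T₂ v x ((t • c₀) x) :=
    continuous_half_localPairing_smul_apply F v N T₂ c₀
  have hqc' : ∀ t : v.adicCompletion F, Continuous fun x : Fin N → v.adicCompletion F =>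
      ⅟(2 : v.adicCompletion F) * localPairing F N T₂ v x ((t • c₀') x) :=
    continuous_half_localPairing_smul_apply F v N T₂ c₀'
  -- the two quadratic forms on `F_v^{ι₁}`
  obtain ⟨Qf, hQf⟩ := exists_quadraticForm_coe_eq e' (localPairing F N T₂ v) c₀
  obtain ⟨Qf', hQf'⟩ := exists_quadraticForm_coe_eq e' (localPairing F N T₂ v) c₀'
  have h2 : (⅟(2 : v.adicCompletion F)) ≠ 0 := (isUnit_of_invertible (⅟(2 : v.adicCompletion F))).ne_zero
  have hQa : Qf.Anisotropic := fun ξ hξ => hanis ξ (by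
    have := congr_fun hQf ξ
    rw [hξ] at this
    have := neg_eq_zero.1 this.symm
    exact (mul_eq_zero.1 this).resolve_left h2)
  have hQa' : Qf'.Anisotropic := fun ξ hξ => hanis' ξ (by
    have := congr_fun hQf' ξ
    rw [hξ] at this
    have := neg_eq_zero.1 this.symm
    exact (mul_eq_zero.1 this).resolve_left h2)
  have hQc : Continuous (⇑Qf : (ι₁ → v.adicCompletion F) → v.adicCompletion F) := by
    rw [hQf]; exact continuous_neg_half_localPairing_glue F v N T₂ e' c₀
  have hQc' : Continuous (⇑Qf' : (ι₁ → v.adicCompletion F) → v.adicCompletion F) := by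
    rw [hQf']; exact continuous_neg_half_localPairing_glue F v N T₂ e' c₀'
  -- the partial Fourier transform implementing `partialWeyl`
  have hwF := implements_partialWeyl_boxFourier (localGram F N T₂ v) hA e' hψ hm hl hb μ₁
  -- the eigen-hypotheses (P5 → P6 glue)
  have hD := eigen_family_of_conj_unipotentSp e' (localPairing F N T₂ v) (adeleAddCharAt F v) hl hb c₀ hc₀ hsupp hqc hU q p
    (fun t => by rw [hq]; exact hconj t) Λ hΛp
  have hDF := eigen_family_of_conj_weyl_unipotentSp e' (localPairing F N T₂ v) (adeleAddCharAt F v) hl hb c₀' hc₀' hsupp'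
    hqc' hU q p' (partialWeyl (localGram F N T₂ v) hA e')
    (boxEquivSB (v.adicCompletion F) e' (piFourierEquivSB μ₁ hψ hm)
      (LinearEquiv.refl ℂ (SchwartzBruhat (ι₂ → v.adicCompletion F)))) hwF
    (fun t => by rw [hq]; exact hconj' t) Λ hΛp'
  -- the uncertainty lemma
  have hD0 : Λ ∘ₗ ((MpPsi.toOp _ q).symm : SchwartzBruhat (Fin N → v.adicCompletion F) →ₗ[ℂ]
      SchwartzBruhat (Fin N → v.adicCompletion F)) = 0 := by
    refine eq_zero_of_quadric_eigen_of_partialFourier_quadric_eigen e' μ₁ hψ hm (⇑Qf) (⇑Qf') hQc hQc'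
      (QuadraticMap.levelSet_subset_piPrimePowBall_of_anisotropic Qf hQa hQc)
      (QuadraticMap.interior_levelSet_eq_empty_of_anisotropic Qf' hQa') _ (fun t => ?_) (fun t => ?_)
    · obtain ⟨κ, hκ⟩ := hD t
      refine ⟨κ, fun Φ Ψ hΦΨ => ?_⟩
      rw [LinearMap.comp_apply, LinearMap.comp_apply, LinearEquiv.coe_coe]
      exact hκ Φ Ψ fun x => by rw [hΦΨ x, hQf]
    · obtain ⟨κ, hκ⟩ := hDF t
      refine ⟨κ, fun Φ Ψ hΦΨ => ?_⟩
      rw [LinearMap.comp_apply, LinearMap.comp_apply, LinearEquiv.coe_coe,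
        ← LinearEquiv.refl_toLinearMap, ← coe_boxEquivSB_eq_sumEndSB]
      exact hκ Φ Ψ fun x => by rw [hΦΨ x, hQf']
  -- `Λ = D ∘ M₀ = 0`
  refine hΛ0 (LinearMap.ext fun f => ?_)
  have := LinearMap.congr_fun hD0 (MpPsi.toOp _ q f)
  rw [LinearMap.comp_apply, LinearEquiv.coe_coe, LinearEquiv.symm_apply_apply, LinearMap.zero_apply] at this
  rw [this, LinearMap.zero_apply]

end Literature.RepresentationTheory.HeisenbergGroup

end
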